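import Literature.Analysis.FluidPDE.ForwardDSSExistence
import Literature.Analysis.FunctionSpaces.WeakLpLocal
import HarnessLib

/-!
# Sibling proof file of `ForwardDSSExistence.lean`

Analysis/FluidPDE proofs file (no new definitions). D-0014: relations between the named facts of
`ForwardDSSExistence.lean` (the decomposition of Bradshaw–Tsai 2019, Thm 1.2) proved here,
leaving the fact file untouched.

* `bradshawTsai2017_dss_localLeray_existence_of_prop_3_1`: Proposition 3.1 as rendered (with the
  existence clause of [BT1] = Bradshaw–Tsai, Ann. Henri Poincaré 18 (2017), Thm 1.2) implies the
  fact `bradshawTsai2017_dss_localLeray_existence` ([BT1], Thm 1.2) outright: the finite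
  `L²(B_λ)`-mass hypothesis of `bradshawTsai2019_prop_3_1.exists_isLocalLeraySolution` holds for
  every `L³_w` datum because `L^{3,∞} ⊂ L²_loc`
  (`Literature.Analysis.FunctionSpaces.MemWeakLp.setLIntegral_enorm_sq_lt_top_of_two_lt`,
  `WeakLpLocal.lean`; Bradshaw–Tsai 2017, §1: "`L³_w(ℝ³)` embeds continuously into the space of
  uniformly locally square integrable functions").

## References

* Z. Bradshaw, T.-P. Tsai, *Forward discretely self-similar solutions of the Navier–Stokes
  equations II*, Ann. Henri Poincaré 18 (2017) 1095–1119 = arXiv:1510.07504, §1 and Thm 1.2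
  [BradshawTsai2017AHP].
* Z. Bradshaw, T.-P. Tsai, Analysis & PDE 12 (2019), Prop. 3.1 [BradshawTsai2019].
-/

noncomputable section

open MeasureTheory Set Metric
open scoped NNReal ENNReal

namespace Literature.Analysis.FluidPDE

/-- **Prop. 3.1 (as rendered, with the existence clause of [BT1]) implies [BT1]'s Theorem 1.2**
(`bradshawTsai2017_dss_localLeray_existence`): an `L³_w` datum has finite `L²(B_λ)`-mass since
`L^{3,∞} ⊂ L²_loc` (`MemWeakLp.setLIntegral_enorm_sq_lt_top_of_two_lt`; Bradshaw–Tsai 2017, §1: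
"`L³_w(ℝ³)` embeds continuously into `L²_{u loc}`"), so
`bradshawTsai2019_prop_3_1.exists_isLocalLeraySolution` applies unconditionally. [cite: BradshawTsai2017AHP, Thm 1.2] -/
theorem bradshawTsai2017_dss_localLeray_existence_of_prop_3_1 (h : bradshawTsai2019_prop_3_1) :
    bradshawTsai2017_dss_localLeray_existence := by
  intro c hc v₀ hw hdiv hdss
  have h3 : (2 : ℝ) < (3 : ℝ≥0∞).toReal := by rw [ENNReal.toReal_ofNat]; norm_num
  exact h.exists_isLocalLeraySolution hc hw hdiv hdss
    (hw.setLIntegral_enorm_sq_lt_top_of_two_lt h3 measure_ball_lt_top.ne)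

end Literature.Analysis.FluidPDE

end
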